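import Literature.Barriers.AtomisticToContinuum.DisorderedHarmonicChainSpectral
import HarnessLib

/-!
# The Casher–Lebowitz chain: temperature algebra of the stationary covariance

Companion to `DisorderedHarmonicChainSpectral.lean` (barrier catalogue
`Literature/Barriers/AtomisticToContinuum/`, sub-problem `FouriersLaw`; provefact unit of
`AjankiHuveneers2011_scaling`, bottom-up step for the named fact
`CasherLebowitz1971_currentFormula` = (F1b)). Everything here is PROVED except the one named
fact (F1b′) at the end, which isolates the analytic content of (F1b):

* `clCov_transpose`, `clCov_eq_add` (linearity of the stationary covariance `B(T_L, T_R)` in the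
  bath temperatures), `clForceMatrix_posDef` (the Dirichlet Laplacian with walls is positive
  definite — no pinning needed), `clGibbsCov m = [[Φ_D⁻¹, 0], [0, M]]` and the Gibbs anchor
  `clCov_self : B(T, T) = T · clGibbsCov` ("`⟨p_l²/m_l⟩ = k_B T_l`", equipartition at equal
  temperatures), `clCov_one_zero_add : B(1,0) + B(0,1) = G`;
* `clRightResponse m λ = λ B_{p₁p₁}(0, 1)/m_1` and
  `clCovFlux_eq_mul_clRightResponse : clCovFlux m λ T_L T_R = (T_L - T_R) · clRightResponse m λ`
  — the stationary current is proportional to the temperature DIFFERENCE, with coefficient the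
  power the cold left bath extracts when the right bath has unit temperature;
* (F1b′) `Dhar2008_rightResponse : clRightResponse m λ = clSpectralConductance m λ` — the
  frequency representation of that coefficient (Dhar 2008 §3.2: `K = ⟨ẊẊᵀ⟩ =
  (k_BT_L/π)∫dω ω² G⁺Γ_LG⁻ + (k_BT_R/π)∫dω ω² G⁺Γ_RG⁻`, §3.4.1: `|G_{1N}| = 1/|det Ẑ|`), and the
  PROVED implication `CasherLebowitz1971_currentFormula_of_rightResponse : (F1b′) → (F1b)`.

(F1b′) is discharged by the frequency-domain solution of the Lyapunov equation
(`Literature/MathematicalPhysics/KineticTheory/LyapunovFrequencyDomain.lean`) together with the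
block inversion of `iω - A` for the chain and the tridiagonal cofactor identity; that assembly is
the next file of the unit.

## Sources

A. Dhar, Adv. Phys. 57 (2008) 457–537, arXiv:0808.3256, §3.1 (matrix equation `a·B + B·aᵀ = D`,
"`⟨x_l H x_l⟩ = ⟨p_l²/m_l⟩ = k_B T_l` … the `equipartition` theorem", heat input
`γ_l/m_l (T^B_l - T_l)`), §3.2 (velocity correlations `K` as frequency integrals);
Bonetto–Lebowitz–Lukkarinen 2004 §2 for the same linear structure (`S_eq = T diag(Φ⁻¹, 1)`,
linearity in the temperature profile) in the unit-mass case, cf. `HarmonicChainCovariance.lean`.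
-/

noncomputable section

open Matrix

namespace Literature.Barriers.AtomisticToContinuum.HeatConduction

open Literature.MathematicalPhysics.KineticTheory.HeatConduction

/-! ### Symmetry and linearity of the stationary covariance -/

/-- The Dirichlet force matrix is symmetric. [folklore] -/
theorem clForceMatrix_transpose {R : Type*} [CommRing R] (n : ℕ) :
    (clForceMatrix n : Matrix (Fin n) (Fin n) R)ᵀ = clForceMatrix n := by
  rw [clForceMatrix, transpose_add, forceMatrix_transpose, diagonal_transpose]

/-- The noise matrix is symmetric (diagonal). [folklore] -/
theorem clNoiseMatrix_transpose {n : ℕ} (m : Fin n → ℝ) (lam T_L T_R : ℝ) :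
    (clNoiseMatrix m lam T_L T_R)ᵀ = clNoiseMatrix m lam T_L T_R := by
  simp only [clNoiseMatrix, fromBlocks_transpose, transpose_zero, diagonal_transpose]

/-- Transpose of the drift matrix: `Aᵀ = [[0, -Φ_D], [M⁻¹, -λE]]`. [folklore] -/
theorem clDriftMatrix_transpose {n : ℕ} (m : Fin n → ℝ) (lam : ℝ) :
    (clDriftMatrix m lam)ᵀ =
      Matrix.fromBlocks 0 (-clForceMatrix n) (Matrix.diagonal fun i => (m i)⁻¹)
        (-frictionMatrix lam n) := by
  rw [clDriftMatrix, fromBlocks_transpose, transpose_zero, transpose_neg, transpose_neg,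
    clForceMatrix_transpose, frictionMatrix_transpose, diagonal_transpose]

/-- The stationary covariance is symmetric (`m > 0`, `λ > 0`). [folklore] -/
theorem clCov_transpose {n : ℕ} {m : Fin n → ℝ} (hm : ∀ k, 0 < m k) {lam : ℝ} (hlam : 0 < lam)
    (T_L T_R : ℝ) : (clCov m lam T_L T_R)ᵀ = clCov m lam T_L T_R :=
  (isHurwitz_clDriftMatrix hm hlam).lyapSol_transpose_of_symm (clNoiseMatrix_transpose m lam T_L T_R)

/-- The noise matrix is linear in the bath temperatures. [folklore] -/
theorem clNoiseMatrix_eq_add {n : ℕ} (m : Fin n → ℝ) (lam T_L T_R : ℝ) :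
    clNoiseMatrix m lam T_L T_R = T_L • clNoiseMatrix m lam 1 0 + T_R • clNoiseMatrix m lam 0 1 := by
  ext a b
  rcases a with i | i <;> rcases b with j | j
  · simp [clNoiseMatrix]
  · simp [clNoiseMatrix]
  · simp [clNoiseMatrix]
  · simp only [clNoiseMatrix, fromBlocks_apply₂₂, Matrix.add_apply, Matrix.smul_apply,
      diagonal_apply, smul_eq_mul, bathTemp]
    split_ifs <;> ring

/-- **Linearity in the temperatures**: `B(T_L, T_R) = T_L B(1, 0) + T_R B(0, 1)`
(`m > 0`, `λ > 0`). [folklore] -/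
theorem clCov_eq_add {n : ℕ} {m : Fin n → ℝ} (hm : ∀ k, 0 < m k) {lam : ℝ} (hlam : 0 < lam)
    (T_L T_R : ℝ) : clCov m lam T_L T_R = T_L • clCov m lam 1 0 + T_R • clCov m lam 0 1 := by
  have hA := isHurwitz_clDriftMatrix hm hlam
  rw [clCov, clNoiseMatrix_eq_add, hA.lyapSol_add, hA.lyapSol_smul, hA.lyapSol_smul]
  rfl

/-! ### The Dirichlet force matrix is positive definite; the Gibbs covariance -/

/-- The quadratic form of the Dirichlet force matrix:
`xᵀ Φ_D x = ∑_{l = k+1} (x_l - x_k)² + ∑ ([i=0]+[i=n-1]) x_i²`. [folklore] -/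
theorem dotProduct_clForceMatrix_mulVec {n : ℕ} (x : Fin n → ℝ) :
    x ⬝ᵥ (clForceMatrix n *ᵥ x) =
      (∑ k : Fin n, ∑ l : Fin n, (if l.val = k.val + 1 then (x l - x k) ^ 2 else 0)) +
        ∑ i, bathMult n i * x i ^ 2 := by
  have h := star_dotProduct_forceMatrix_mulVec (0 : ℝ) x
  simp only [star_trivial] at h
  rw [clForceMatrix, add_mulVec, dotProduct_add, h, zero_mul, zero_add]
  congr 1
  · refine Finset.sum_congr rfl fun k _ => Finset.sum_congr rfl fun l _ => ?_
    split_ifs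
    · ring
    · rfl
  · simp only [dotProduct, mulVec_diagonal]
    exact Finset.sum_congr rfl fun i _ => by ring

/-- **The Dirichlet force matrix is positive definite** (no pinning needed: a vector with
`xᵀΦ_D x = 0` vanishes at the wall site `0` and is constant along the bonds). [folklore] -/
theorem clForceMatrix_posDef (n : ℕ) : (clForceMatrix n : Matrix (Fin n) (Fin n) ℝ).PosDef := by
  refine Matrix.PosDef.of_dotProduct_mulVec_pos ?_ fun x hx => ?_
  · rw [Matrix.IsHermitian, conjTranspose_eq_transpose_of_trivial, clForceMatrix_transpose]
  · rw [star_trivial, dotProduct_clForceMatrix_mulVec]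
    have hb : ∀ k l : Fin n, 0 ≤ (if l.val = k.val + 1 then (x l - x k) ^ 2 else 0) :=
      fun k l => by
        split_ifs
        · exact sq_nonneg _
        · exact le_rfl
    have hw : ∀ i, 0 ≤ bathMult n i * x i ^ 2 := fun i =>
      mul_nonneg (bathMult_nonneg n i) (sq_nonneg _)
    have hB : 0 ≤ ∑ k : Fin n, ∑ l : Fin n, (if l.val = k.val + 1 then (x l - x k) ^ 2 else 0) :=
      Finset.sum_nonneg fun k _ => Finset.sum_nonneg fun l _ => hb k l
    have hW : 0 ≤ ∑ i, bathMult n i * x i ^ 2 := Finset.sum_nonneg fun i _ => hw i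
    by_contra hle
    have h0 := le_antisymm (not_lt.mp hle) (add_nonneg hB hW)
    have hB0 : ∑ k : Fin n, ∑ l : Fin n, (if l.val = k.val + 1 then (x l - x k) ^ 2 else 0) = 0 := by
      linarith
    have hW0 : ∑ i, bathMult n i * x i ^ 2 = 0 := by linarith
    -- the wall site
    have hx0 : ∀ a : Fin n, a.val = 0 → x a = 0 := by
      intro a ha
      have hterm := (Finset.sum_eq_zero_iff_of_nonneg fun i _ => hw i).mp hW0 a (Finset.mem_univ a)
      have h1 := one_le_bathMult a ha
      rcases mul_eq_zero.mp hterm with h2 | h2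
      · linarith
      · exact pow_eq_zero_iff (n := 2) (by norm_num) |>.mp h2
    -- the bonds
    have hstep : ∀ k l : Fin n, l.val = k.val + 1 → x l = x k := by
      intro k l hkl
      have hk := (Finset.sum_eq_zero_iff_of_nonneg fun k _ =>
        Finset.sum_nonneg fun l _ => hb k l).mp hB0 k (Finset.mem_univ k)
      have hl := (Finset.sum_eq_zero_iff_of_nonneg fun l _ => hb k l).mp hk l (Finset.mem_univ l)
      rw [if_pos hkl] at hl
      have : x l - x k = 0 := pow_eq_zero_iff (n := 2) (by norm_num) |>.mp hl
      linarith
    apply hx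
    funext a
    suffices h : ∀ j : ℕ, ∀ a : Fin n, a.val = j → x a = 0 from h a.val a rfl
    intro j
    induction j with
    | zero => exact hx0
    | succ j ih =>
      intro a ha
      have hj : j < n := by omega
      rw [hstep ⟨j, hj⟩ a (by simp [ha])]
      exact ih ⟨j, hj⟩ rfl

/-- The Gibbs covariance of the Casher–Lebowitz chain at unit temperature,
`G = [[Φ_D⁻¹, 0], [0, M]]` (covariance of `∝ e^{-H}`, `H = ½pᵀM⁻¹p + ½qᵀΦ_D q`). [folklore] -/
def clGibbsCov {n : ℕ} (m : Fin n → ℝ) : Matrix (Fin n ⊕ Fin n) (Fin n ⊕ Fin n) ℝ :=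
  Matrix.fromBlocks (clForceMatrix n)⁻¹ 0 0 (Matrix.diagonal m)

/-- The momentum block of the Gibbs covariance is the mass matrix. [folklore] -/
theorem clGibbsCov_inr_inr {n : ℕ} (m : Fin n → ℝ) (i j : Fin n) :
    clGibbsCov m (Sum.inr i) (Sum.inr j) = if i = j then m i else 0 := by
  simp [clGibbsCov, diagonal_apply]

/-- **Equal temperatures: the Gibbs state.** `B(T, T) = T · [[Φ_D⁻¹, 0], [0, M]]`
(fluctuation–dissipation: `A G + G Aᵀ = -[[0,0],[0, 2λEM]]` is compensated by the noise
`2λ T M E`). [cite: Dhar2008, §3.1] -/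
theorem clCov_self {n : ℕ} {m : Fin n → ℝ} (hm : ∀ k, 0 < m k) {lam : ℝ} (hlam : 0 < lam)
    (T : ℝ) : clCov m lam T T = T • clGibbsCov m := by
  symm
  apply eq_clCov hm hlam
  have hunit : IsUnit (clForceMatrix n : Matrix (Fin n) (Fin n) ℝ).det :=
    (isUnit_iff_isUnit_det _).mp (clForceMatrix_posDef n).isUnit
  have h1 : (clForceMatrix n : Matrix (Fin n) (Fin n) ℝ) * (clForceMatrix n)⁻¹ = 1 :=
    mul_nonsing_inv _ hunit
  have h2 : (clForceMatrix n : Matrix (Fin n) (Fin n) ℝ)⁻¹ * clForceMatrix n = 1 :=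
    nonsing_inv_mul _ hunit
  have hMM : (Matrix.diagonal fun i => (m i)⁻¹) * Matrix.diagonal m = 1 := by
    rw [diagonal_mul_diagonal, ← diagonal_one]
    congr 1
    funext i
    exact inv_mul_cancel₀ (hm i).ne'
  have hMM' : Matrix.diagonal m * (Matrix.diagonal fun i => (m i)⁻¹) = 1 := by
    rw [diagonal_mul_diagonal, ← diagonal_one]
    congr 1
    funext i
    exact mul_inv_cancel₀ (hm i).ne'
  have hΓM : frictionMatrix lam n * Matrix.diagonal m =
      Matrix.diagonal fun i => lam * bathMult n i * m i := by
    rw [frictionMatrix, diagonal_mul_diagonal]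
  have hMΓ : Matrix.diagonal m * frictionMatrix lam n =
      Matrix.diagonal fun i => lam * bathMult n i * m i := by
    rw [frictionMatrix, diagonal_mul_diagonal]
    congr 1
    funext i
    ring
  have hAG : clDriftMatrix m lam * clGibbsCov m =
      Matrix.fromBlocks 0 1 (-1) (-Matrix.diagonal fun i => lam * bathMult n i * m i) := by
    rw [clDriftMatrix, clGibbsCov, fromBlocks_multiply]
    simp only [Matrix.zero_mul, Matrix.mul_zero, add_zero, zero_add, Matrix.neg_mul, h1, hMM, hΓM]
  have hGA : clGibbsCov m * (clDriftMatrix m lam)ᵀ =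
      Matrix.fromBlocks 0 (-1) 1 (-Matrix.diagonal fun i => lam * bathMult n i * m i) := by
    rw [clDriftMatrix_transpose, clGibbsCov, fromBlocks_multiply]
    simp only [Matrix.zero_mul, Matrix.mul_zero, add_zero, zero_add, Matrix.mul_neg, h2, hMM', hMΓ,
      neg_zero]
  rw [Matrix.mul_smul, Matrix.smul_mul, hAG, hGA, ← smul_add, fromBlocks_add, clNoiseMatrix,
    fromBlocks_smul, fromBlocks_add, ← fromBlocks_zero, fromBlocks_inj]
  refine ⟨by simp, by simp, by simp, ?_⟩
  ext i j
  simp only [Matrix.add_apply, Matrix.smul_apply, Matrix.neg_apply, diagonal_apply, bathTemp_self,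
    smul_eq_mul, Matrix.zero_apply]
  split_ifs <;> ring

/-- `B(1, 0) + B(0, 1) = G`: the two one-bath covariances add up to the unit-temperature Gibbs
covariance. [folklore] -/
theorem clCov_one_zero_add {n : ℕ} {m : Fin n → ℝ} (hm : ∀ k, 0 < m k) {lam : ℝ}
    (hlam : 0 < lam) : clCov m lam 1 0 + clCov m lam 0 1 = clGibbsCov m := by
  have h := clCov_eq_add hm hlam 1 1
  rw [one_smul, one_smul, clCov_self hm hlam 1, one_smul] at h
  exact h.symm

/-! ### The left-bath power is `(T_L - T_R)` times the right-bath response -/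

/-- The right-bath response coefficient of the Casher–Lebowitz chain:
`λ B_{p₁p₁}(T_L = 0, T_R = 1)/m_1`, the power the left bath (at temperature `0`) extracts when
the right bath has unit temperature — written as a sum over `k.val = 0` like `clLeftFlux`.
By `clCovFlux_eq_mul_clRightResponse` the stationary current at temperatures `(T_L, T_R)` is
`(T_L - T_R)` times this coefficient. [cite: Dhar2008, §3.1] -/
def clRightResponse {n : ℕ} (m : Fin n → ℝ) (lam : ℝ) : ℝ :=
  ∑ k : Fin n, if k.val = 0 then lam * clCov m lam 0 1 (Sum.inr k) (Sum.inr k) / m k else 0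

/-- **The current is proportional to the temperature difference**:
`λ(T_L - B_{p₁p₁}(T_L,T_R)/m_1) = (T_L - T_R) · λ B_{p₁p₁}(0,1)/m_1`, by linearity of `B` in the
temperatures and the Gibbs anchor `B_{p₁p₁}(1,0) + B_{p₁p₁}(0,1) = m_1` (no current at
equilibrium). [cite: Dhar2008, §3.1] -/
theorem clCovFlux_eq_mul_clRightResponse {n : ℕ} {m : Fin n → ℝ} (hm : ∀ k, 0 < m k)
    {lam : ℝ} (hlam : 0 < lam) (T_L T_R : ℝ) :
    clCovFlux m lam T_L T_R = (T_L - T_R) * clRightResponse m lam := by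
  unfold clCovFlux clRightResponse
  rw [Finset.mul_sum]
  refine Finset.sum_congr rfl fun k _ => ?_
  split_ifs with hk
  · have hsum := congrFun (congrFun (clCov_one_zero_add hm hlam) (Sum.inr k)) (Sum.inr k)
    rw [Matrix.add_apply, clGibbsCov_inr_inr, if_pos rfl] at hsum
    rw [clCov_eq_add hm hlam T_L T_R, Matrix.add_apply, Matrix.smul_apply, Matrix.smul_apply,
      smul_eq_mul, smul_eq_mul]
    have h10 : clCov m lam 1 0 (Sum.inr k) (Sum.inr k) = m k - clCov m lam 0 1 (Sum.inr k) (Sum.inr k) := by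
      linarith
    rw [h10]
    have hmk : m k ≠ 0 := (hm k).ne'
    field_simp
    ring
  · simp

end Literature.Barriers.AtomisticToContinuum.HeatConduction

namespace Literature.Barriers.AtomisticToContinuum

open Literature.MathematicalPhysics.KineticTheory.HeatConduction HeatConduction

/-- **(F1b′) The frequency representation of the right-bath response** (Dhar 2008, §3.2: the
stationary velocity correlations are `K = ⟨ẊẊᵀ⟩ = (k_BT_L/π)∫dω ω² G⁺Γ_LG⁻ + (k_BT_R/π)∫dω ω² G⁺Γ_RG⁻`,
with §3.4.1 `|G_{1N}| = 1/|det Ẑ|`): for positive masses and `λ > 0`, with `T_L = 0`, `T_R = 1`,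
`⟨p_1²⟩/m_1² = K_{11} = (1/π)∫ ω² λ m_n |G_{1n}(ω)|² dω`, i.e.
`λ B_{p₁p₁}(0,1)/m_1 = (λ² m_1 m_n/π) ∫_ℝ ω² |det Z_n(ω)|^{-2} dω`:
`clRightResponse m λ = clSpectralConductance m λ`. This is the analytic content of the
Casher–Lebowitz formula (frequency-domain solution `(1/2π)∫(iω-A)⁻¹Σ(iω-A)^{-*}dω` of the Lyapunov
equation for the Hurwitz matrix `A`, block inversion of `iω - A`, cofactor identity
`(Z⁻¹)_{1n} = 1/det Z`); `CasherLebowitz1971_currentFormula` follows from it by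
`CasherLebowitz1971_currentFormula_of_rightResponse`. [cite: Dhar2008, §3.2 (formula for `K`) and §3.4.1] -/
def Dhar2008_rightResponse : Prop :=
  ∀ (n : ℕ) (m : Fin n → ℝ), (∀ k, 0 < m k) → ∀ lam : ℝ, 0 < lam →
    clRightResponse m lam = clSpectralConductance m lam

/-- (F1b) from (F1b′) and the proved temperature algebra of the covariance.
[cite: Dhar2008, §3.1 and §3.2] -/
theorem CasherLebowitz1971_currentFormula_of_rightResponse (h : Dhar2008_rightResponse) :
    CasherLebowitz1971_currentFormula := by
  intro n m hm lam hlam T_L T_R _ _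
  rw [clCovFlux_eq_mul_clRightResponse hm hlam, h n m hm lam hlam]

end Literature.Barriers.AtomisticToContinuum

end
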